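import Summits.AtomisticToContinuum.BoseEinsteinCondensation.Theorems.BECRewardDescentRewardChordBoundSlotAverage
import Literature.Analysis.FunctionSpaces.TorusPairDist
import Summits.AtomisticToContinuum.BoseEinsteinCondensation.Theorems.BECRewardDescentRewardChordBoundFreeRegionSpreadingGeometry
import HarnessLib
-- module: Summits.AtomisticToContinuum.BoseEinsteinCondensation.Theorems.BECRewardDescentRewardChordBoundTeleportDescentTools

/-!
# Descent to the free region, tools (crux `RewardChordBound`, stmt-AtomisticToContinuum-12876, stub R2
# `stub_teleportPackage`, helper file 4a): fibre mass, the far region of a parked particle, free-particle counts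

For `L > 0`, measurable `v` vanishing beyond `R₀ ≥ 0`, `s > 0`, the one-particle room condition
`N·(4π/3)(R₀/L)³ < 1`, and a non-negative Bose-symmetric `η ≠ 0` of finite maximal form satisfying the rewarded
Euler–Lagrange identity: `η` does NOT vanish a.e. on the free region `U₀ = {t | ∀ j ≠ k, R₀/L < ρⱼₖ(t)}`.

THIS FILE holds the measure-theoretic and geometric tools of the proof; helper file 4b runs the induction.
Proof (downward induction on the number of free particles). Call particle `i` FREE in `t` if `ρᵢⱼ(t) > R₀/L` for
all `j ≠ i`, and let `Z(k)`: "`η = 0` a.e. on `{#free ≥ k}`". `Z(N)` is the hypothesis to be refuted; we show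
`Z(k+1) ⇒ Z(k)` for `k < N`, so `Z(0)`: `η = 0`, absurd. If `Z(k+1)` holds and `Z(k)` fails, the set
`E = {#free = k, η ≠ 0}` is non-null and some NON-free particle `i` is non-free on a non-null part `Eᵢ` of it.
Park particle `i`: for `t ∈ Eᵢ` and `c` in the FAR region (particle `i` moved to nearest-image distance
`> R₀/L + 2δ` from everybody; of positive Haar measure by the room condition and `haar_normBall_le`), the parked
configuration `t' = t + σᵢ c` has `≥ k + 1` free particles, so `η(t') = 0` (`Z(k+1)`, pulled back through the
measure-preserving shear); the heredity transform `θ = ∑ gᵢ·(Pᵢη)` (registered sub-goal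
`stub_teleportPackage_Heredity`) is an admissible test class with `θ(t') ≥ gᵢ(t')·(Pᵢη)(t') = (Pᵢη)(t) > 0`
(a.e. `t` with `η(t) ≠ 0` carries fibre mass — `ae_fibreMass_ne_zero`, by averaging over the fibre); so the
teleport lemma (helper 2b) gives `(Pᵢη)(t') = 0`, i.e. the fibre through `t' `— which is the fibre through `t` — is
`η`-null, contradicting the fibre mass at `t`. All "a.e." bookkeeping goes through the product `(t, c)` and the
shear `t + σᵢ c` (helper 1).

References: M. Reed, B. Simon, *Methods of Modern Mathematical Physics IV* (1978), Thm XIII.44 [ReedSimonIV1978].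
-/

noncomputable section

open MeasureTheory Filter Set Complex UnitAddTorus
open scoped ENNReal NNReal Topology InnerProductSpace ComplexConjugate
open Literature.Analysis.FunctionSpaces Literature.Analysis.OperatorTheory Literature.Analysis.InnerProduct

namespace Summit.AtomisticToContinuum.BoseEinsteinCondensation.Cruxes.RewardChordBound.Birth.Teleport

open Literature.MathematicalPhysics.QuantumManyBody.BoseGas
open Summit.AtomisticToContinuum.BoseEinsteinCondensation.Cruxes.RewardChordBound.Birth.SlotAverage
open Summit.AtomisticToContinuum.BoseEinsteinCondensation.Cruxes.RewardChordBound.Birth.FreeRegionSpreading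

-- The measure on `ℝ/ℤ` is the Haar PROBABILITY measure, as in `PeriodicFormDomain.lean`.
attribute [local instance] Literature.MathematicalPhysics.QuantumManyBody.BoseGas.formDomain_measureSpace
  Literature.MathematicalPhysics.QuantumManyBody.BoseGas.formDomain_isProbabilityMeasure
  Literature.MathematicalPhysics.QuantumManyBody.BoseGas.formDomain_isProbabilityMeasure_pi

-- Translation invariance of the Haar (product) measures (closed local-instance defs of the tree).
attribute [local instance] Literature.MathematicalPhysics.QuantumManyBody.BoseGas.slotShift_isAddRightInvariant
  Literature.MathematicalPhysics.QuantumManyBody.BoseGas.configFourier_isAddLeftInvariant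
  Literature.MathematicalPhysics.QuantumManyBody.BoseGas.configFourier_isAddLeftInvariant_pi

variable {N : ℕ} {L : ℝ} {v : ℝ → ℝ≥0∞}

/-- Local notation for the Hilbert space `L²((ℝ/ℤ)^{3N})`, as in `PeriodicFormDomain.lean`. -/
local notation "L2T " N':max => Lp ℂ 2 (volume : Measure (UnitAddTorus (Fin N' × Fin 3)))

/-- Local notation for the configuration torus `(ℝ/ℤ)^{N×3}`. -/
local notation "TN " N':max => UnitAddTorus (Fin N' × Fin 3)

/-- Local notation for the one-particle torus `(ℝ/ℤ)³`. -/
local notation "T3" => UnitAddTorus (Fin 3)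

/-! ### Slot shifts and pair distances -/

/-- The one-slot shift is additive in the shift. [folklore] -/
theorem slotShift_add (i : Fin N) (c c' : T3) : slotShift i (c + c') = slotShift i c + slotShift i c' := by
  funext p
  by_cases hp : p.1 = i
  · simp only [slotShift, hp, if_true, Pi.add_apply]
  · simp only [slotShift, hp, if_false, Pi.add_apply, add_zero]

/-- Moving particle `i` does not change the distances between the other particles. [folklore] -/
theorem pairDist_add_slotShift_of_ne {i j l : Fin N} (hj : j ≠ i) (hl : l ≠ i) (t : TN N) (c : T3) :
    Torus.pairDist j l (t + slotShift i c) = Torus.pairDist j l t := by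
  unfold Torus.pairDist
  congr 1
  refine Finset.sum_congr rfl fun k _ => ?_
  simp only [Pi.add_apply, slotShift_apply_of_ne hj, slotShift_apply_of_ne hl, add_zero]

/-- After moving particle `i` by `c`, its squared distance to particle `j` is `∑ₖ ‖c k - (t(j,k) - t(i,k))‖²`.
[folklore] -/
theorem pairDist_add_slotShift_sq {i j : Fin N} (hj : j ≠ i) (t : TN N) (c : T3) :
    Torus.pairDist i j (t + slotShift i c) ^ 2 = ∑ k : Fin 3, ‖c k - (t (j, k) - t (i, k))‖ ^ 2 := by
  rw [Torus.pairDist_sq]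
  refine Finset.sum_congr rfl fun k _ => ?_
  simp only [Pi.add_apply, slotShift_apply_same, slotShift_apply_of_ne hj, add_zero]
  congr 1
  abel

/-- A.e. statements pull back through the shear `(t, c) ↦ t + σᵢ c` (no measurability of the predicate needed:
pass to a measurable null superset of the exceptional set). [folklore] -/
theorem ae_prod_comp_add_slotShift' (i : Fin N) {P : TN N → Prop} (h : ∀ᵐ t : TN N, P t) :
    ∀ᵐ p : TN N × T3, P (p.1 + slotShift i p.2) := by
  rw [Filter.Eventually, mem_ae_iff] at h
  obtain ⟨S, hsub, hSm, hS0⟩ := exists_measurable_superset_of_null h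
  have h0 := measure_preimage_add_slotShift_eq_zero i hSm hS0
  rw [ae_iff]
  refine measure_mono_null (fun p hp => ?_) h0
  exact hsub hp

/-! ### Fibre mass -/

section FibreMass

variable (i : Fin N) (η : L2T N)

/-- The fibre mass `M(t) = ∫⁻ ‖η(t + σᵢ c)‖ₑ dc` is measurable. [folklore] -/
theorem measurable_fibreMass : Measurable fun t : TN N => ∫⁻ c : T3, ‖(η : TN N → ℂ) (t + slotShift i c)‖ₑ := by
  have h : Measurable (Function.uncurry fun (t : TN N) (c : T3) => ‖(η : TN N → ℂ) (t + slotShift i c)‖ₑ) :=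
    (measurable_comp_add_slotShift i η).enorm
  exact h.lintegral_prod_right'

/-- The fibre mass is constant along the fibre. [folklore] -/
theorem fibreMass_add_slotShift (t : TN N) (c : T3) :
    ∫⁻ c' : T3, ‖(η : TN N → ℂ) (t + slotShift i c + slotShift i c')‖ₑ =
      ∫⁻ c' : T3, ‖(η : TN N → ℂ) (t + slotShift i c')‖ₑ := by
  have h := lintegral_add_left_eq_self (μ := (volume : Measure T3))
    (fun c' => ‖(η : TN N → ℂ) (t + slotShift i c')‖ₑ) c
  refine Eq.trans (lintegral_congr fun c' => ?_) h
  rw [add_assoc, ← slotShift_add]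

/-- **A.e. non-zero points carry fibre mass**: for a.e. `t`, `η(t) ≠ 0` implies `∫⁻ ‖η(t + σᵢ c)‖ₑ dc ≠ 0`
(averaging `𝟙{M = 0}·‖η‖ₑ` over the fibre). [folklore] -/
theorem ae_fibreMass_ne_zero :
    ∀ᵐ t : TN N, (η : TN N → ℂ) t ≠ 0 → (∫⁻ c : T3, ‖(η : TN N → ℂ) (t + slotShift i c)‖ₑ) ≠ 0 := by
  set M : TN N → ℝ≥0∞ := fun t => ∫⁻ c : T3, ‖(η : TN N → ℂ) (t + slotShift i c)‖ₑ with hMdef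
  have hM : Measurable M := measurable_fibreMass i η
  have hZ : MeasurableSet {t : TN N | M t = 0} := hM (measurableSet_singleton 0)
  have hηm : Measurable fun t : TN N => ‖(η : TN N → ℂ) t‖ₑ := (Lp.stronglyMeasurable η).measurable.enorm
  set F : TN N → ℝ≥0∞ := fun t => {t : TN N | M t = 0}.indicator (1 : TN N → ℝ≥0∞) t * ‖(η : TN N → ℂ) t‖ₑ
    with hFdef
  have hind : Measurable fun t : TN N => {t : TN N | M t = 0}.indicator (1 : TN N → ℝ≥0∞) t :=
    measurable_one.indicator hZ
  have hFm : Measurable F := hind.mul hηm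
  -- `M`, hence the indicator, is invariant along the fibre
  have hMinv : ∀ (t : TN N) (c : T3), M (t + slotShift i c) = M t := fun t c => fibreMass_add_slotShift i η t c
  have hIinv : ∀ (t : TN N) (c : T3), {t : TN N | M t = 0}.indicator (1 : TN N → ℝ≥0∞) (t + slotShift i c) =
      {t : TN N | M t = 0}.indicator (1 : TN N → ℝ≥0∞) t := by
    intro t c
    simp only [Set.indicator, Set.mem_setOf_eq, hMinv, Pi.one_apply]
  -- `∫ F = ∫∫ F(t + σᵢ c) = ∫ 𝟙{M = 0} M = 0`
  have hkey : ∫⁻ t, F t = 0 := by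
    rw [← lintegral_comp_add_slotShift i hFm, Measure.volume_eq_prod,
      lintegral_prod (fun p : TN N × T3 => F (p.1 + slotShift i p.2))
        (hFm.comp (measurable_add_slotShift i)).aemeasurable]
    have h3 : ∀ t : TN N, ∫⁻ c : T3, F (t + slotShift i c) =
        {t : TN N | M t = 0}.indicator (1 : TN N → ℝ≥0∞) t * M t := by
      intro t
      simp only [hFdef, hIinv]
      rw [lintegral_const_mul]
      exact (((Lp.stronglyMeasurable η).measurable.comp (measurable_const.add (measurable_slotShift i))).enorm)
    simp only [h3]
    rw [lintegral_eq_zero_iff (show Measurable (fun t : TN N => {t : TN N | M t = 0}.indicator (1 : TN N → ℝ≥0∞) t * M t)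
      from hind.mul hM)]
    refine Eventually.of_forall fun t => ?_
    show {t : TN N | M t = 0}.indicator (1 : TN N → ℝ≥0∞) t * M t = 0
    by_cases ht : t ∈ {t : TN N | M t = 0}
    · rw [Set.indicator_of_mem ht, Pi.one_apply, one_mul]; exact ht
    · rw [Set.indicator_of_notMem ht, zero_mul]
  have hae : F =ᵐ[volume] 0 := (lintegral_eq_zero_iff hFm).1 hkey
  filter_upwards [hae] with t ht hη0 hM0
  have hmem : t ∈ {t : TN N | M t = 0} := hM0
  rw [hFdef] at ht
  simp only [Pi.zero_apply, Set.indicator_of_mem hmem, Pi.one_apply, one_mul, enorm_eq_zero] at ht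
  exact hη0 ht

end FibreMass

/-! ### The far region of a parked particle has positive measure -/

section Far

/-- **The far region has positive measure.** For `t`, a slot `i`, `b' ≥ 0` with `N·(4π/3)b'³ < 1`: the spots `c`
placing particle `i` at nearest-image distance `> b'` from all other particles have positive Haar measure (the
complement is covered by `N - 1` balls of radius `b'`, `haar_normBall_le`). [folklore] -/
theorem measure_far_ne_zero (i : Fin N) (t : TN N) {b' : ℝ} (hb' : 0 ≤ b')
    (hroom : (N : ℝ) * (4 / 3 * Real.pi * b' ^ 3) < 1) :
    volume {c : T3 | ∀ j : Fin N, j ≠ i → b' < Torus.pairDist i j (t + slotShift i c)} ≠ 0 := by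
  set Far : Set T3 := {c : T3 | ∀ j : Fin N, j ≠ i → b' < Torus.pairDist i j (t + slotShift i c)} with hFar
  -- the complement is covered by the balls around `q_j = t(j,·) - t(i,·)`
  set Ball : Fin N → Set T3 := fun j => {c : T3 | ∑ k : Fin 3, ‖c k - (t (j, k) - t (i, k))‖ ^ 2 ≤ b' ^ 2}
    with hBall
  have hcover : Farᶜ ⊆ ⋃ j ∈ Finset.univ.erase i, Ball j := by
    intro c hc
    simp only [hFar, Set.mem_compl_iff, Set.mem_setOf_eq, not_forall, not_lt, exists_prop] at hc
    obtain ⟨j, hj, hle⟩ := hc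
    refine Set.mem_iUnion₂.2 ⟨j, Finset.mem_erase.2 ⟨hj, Finset.mem_univ _⟩, ?_⟩
    simp only [hBall, Set.mem_setOf_eq, ← pairDist_add_slotShift_sq hj t c]
    exact pow_le_pow_left₀ (Torus.pairDist_nonneg _ _ _) hle 2
  have hballs : volume (⋃ j ∈ Finset.univ.erase i, Ball j) < 1 := by
    calc volume (⋃ j ∈ Finset.univ.erase i, Ball j)
        ≤ ∑ j ∈ Finset.univ.erase i, volume (Ball j) := measure_biUnion_finset_le _ _
      _ ≤ ∑ _j ∈ Finset.univ.erase i, ENNReal.ofReal b' ^ 3 * ENNReal.ofReal (Real.pi * 4 / 3) :=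
          Finset.sum_le_sum fun j _ => haar_normBall_le (fun k => t (j, k) - t (i, k)) hb'
      _ = ((Finset.univ.erase i).card : ℝ≥0∞) * (ENNReal.ofReal b' ^ 3 * ENNReal.ofReal (Real.pi * 4 / 3)) := by
          rw [Finset.sum_const, nsmul_eq_mul]
      _ ≤ (N : ℝ≥0∞) * (ENNReal.ofReal b' ^ 3 * ENNReal.ofReal (Real.pi * 4 / 3)) := by
          gcongr
          have h := Finset.card_erase_le (s := (Finset.univ : Finset (Fin N))) (a := i)
          rw [Finset.card_univ, Fintype.card_fin] at h
          exact_mod_cast h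
      _ = ENNReal.ofReal ((N : ℝ) * (4 / 3 * Real.pi * b' ^ 3)) := by
          rw [← ENNReal.ofReal_pow hb', ← ENNReal.ofReal_mul (pow_nonneg hb' 3), ← ENNReal.ofReal_natCast,
            ← ENNReal.ofReal_mul (Nat.cast_nonneg N)]
          congr 1
          ring
      _ < 1 := by
          rw [← ENNReal.ofReal_one]
          exact (ENNReal.ofReal_lt_ofReal_iff one_pos).2 hroom
  have hFm : MeasurableSet Far := by
    have hopen : IsOpen Far := by
      rw [hFar, show {c : T3 | ∀ j : Fin N, j ≠ i → b' < Torus.pairDist i j (t + slotShift i c)} =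
        ⋂ j ∈ Finset.univ.erase i, {c : T3 | b' < Torus.pairDist i j (t + slotShift i c)} by
          ext c
          simp only [Set.mem_setOf_eq, Set.mem_iInter, Finset.mem_erase, Finset.mem_univ, and_true]]
      refine isOpen_biInter_finset fun j _ => ?_
      exact isOpen_lt continuous_const
        ((Torus.continuous_pairDist i j).comp (continuous_const.add (continuous_slotShift i)))
    exact hopen.measurableSet
  intro h0
  have h1 : volume Farᶜ = 1 := by
    rw [measure_compl hFm (measure_ne_top _ _), h0, measure_univ, tsub_zero]
  have h2 : volume Farᶜ < 1 := (measure_mono hcover).trans_lt hballs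
  rw [h1] at h2
  exact lt_irrefl _ h2

end Far

/-! ### Free particles -/

section Free

/-- **Parking frees one more particle**: if particle `i` is not free in `t` and is moved to a spot at distance `> r`
from everybody, the number of free particles goes up (the old free particles stay free, `i` becomes free).
[folklore] -/
theorem card_free_add_slotShift_ge (r : ℝ) (i : Fin N) (t : TN N) (c : T3)
    (hnot : ¬ ∀ j : Fin N, j ≠ i → r < Torus.pairDist i j t)
    (hfar : ∀ j : Fin N, j ≠ i → r < Torus.pairDist i j (t + slotShift i c)) :
    (Finset.univ.filter fun a : Fin N => ∀ j : Fin N, j ≠ a → r < Torus.pairDist a j t).card + 1 ≤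
      (Finset.univ.filter fun a : Fin N => ∀ j : Fin N, j ≠ a → r < Torus.pairDist a j (t + slotShift i c)).card := by
  classical
  set F : Finset (Fin N) := Finset.univ.filter fun a : Fin N => ∀ j : Fin N, j ≠ a → r < Torus.pairDist a j t
    with hF
  set F' : Finset (Fin N) := Finset.univ.filter fun a : Fin N =>
    ∀ j : Fin N, j ≠ a → r < Torus.pairDist a j (t + slotShift i c) with hF'
  have hi : i ∉ F := by
    rw [hF, Finset.mem_filter]; exact fun h => hnot h.2
  have hsub : insert i F ⊆ F' := by
    intro a ha
    rw [Finset.mem_insert] at ha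
    rw [hF', Finset.mem_filter]
    refine ⟨Finset.mem_univ _, ?_⟩
    rcases ha with rfl | ha
    · exact hfar
    · have ha' := (Finset.mem_filter.1 ha).2
      have hai : a ≠ i := fun h => hi (h ▸ ha)
      intro j hj
      by_cases hji : j = i
      · subst hji
        rw [Torus.pairDist_comm]
        exact hfar a hai
      · rw [pairDist_add_slotShift_of_ne hai hji]
        exact ha' j hj
  calc F.card + 1 = (insert i F).card := (Finset.card_insert_of_notMem hi).symm
    _ ≤ F'.card := Finset.card_le_card hsub

/-- All particles are free exactly on the free region. [folklore] -/
theorem free_of_card_ge (r : ℝ) (t : TN N)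
    (h : N ≤ (Finset.univ.filter fun a : Fin N => ∀ j : Fin N, j ≠ a → r < Torus.pairDist a j t).card) :
    ∀ j k : Fin N, j ≠ k → r < Torus.pairDist j k t := by
  classical
  have hall : (Finset.univ.filter fun a : Fin N => ∀ j : Fin N, j ≠ a → r < Torus.pairDist a j t) = Finset.univ := by
    refine Finset.eq_univ_of_card _ (le_antisymm (Finset.card_le_univ _) ?_)
    rwa [Fintype.card_fin]
  intro j k hjk
  have hj : j ∈ (Finset.univ.filter fun a : Fin N => ∀ j : Fin N, j ≠ a → r < Torus.pairDist a j t) := by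
    rw [hall]; exact Finset.mem_univ _
  exact (Finset.mem_filter.1 hj).2 k (Ne.symm hjk)

/-- The free-particle count is a measurable function. [folklore] -/
theorem measurable_card_free (r : ℝ) :
    Measurable fun t : TN N =>
      (Finset.univ.filter fun a : Fin N => ∀ j : Fin N, j ≠ a → r < Torus.pairDist a j t).card := by
  classical
  have h : (fun t : TN N => (Finset.univ.filter fun a : Fin N => ∀ j : Fin N, j ≠ a → r < Torus.pairDist a j t).card) =
      fun t => ∑ a : Fin N, if (∀ j : Fin N, j ≠ a → r < Torus.pairDist a j t) then 1 else 0 := by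
    funext t
    rw [Finset.card_filter]
  rw [h]
  refine Finset.measurable_sum _ fun a _ => Measurable.ite ?_ measurable_const measurable_const
  have hopen : IsOpen {t : TN N | ∀ j : Fin N, j ≠ a → r < Torus.pairDist a j t} := by
    rw [show {t : TN N | ∀ j : Fin N, j ≠ a → r < Torus.pairDist a j t} =
      ⋂ j ∈ Finset.univ.erase a, {t : TN N | r < Torus.pairDist a j t} by
        ext t
        simp only [Set.mem_setOf_eq, Set.mem_iInter, Finset.mem_erase, Finset.mem_univ, and_true, ne_comm]]
    exact isOpen_biInter_finset fun j _ => isOpen_lt continuous_const (Torus.continuous_pairDist a j)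
  exact hopen.measurableSet

end Free

end Summit.AtomisticToContinuum.BoseEinsteinCondensation.Cruxes.RewardChordBound.Birth.Teleport

namespace Summit.AtomisticToContinuum.BoseEinsteinCondensation.Cruxes.RewardChordBound.Birth

open Summit.AtomisticToContinuum.BoseEinsteinCondensation.Cruxes.RewardChordBound.Birth.Teleport
  Literature.MathematicalPhysics.QuantumManyBody.BoseGas

/-- **Registered sub-goal of stub `stub_teleportPackage` (helper file 4a, fibre mass): a.e. non-zero points of an
`L²` class carry fibre mass** — for a slot `i`, at a.e. `t` with `η(t) ≠ 0` the one-particle fibre through `t` is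
not `η`-null, `∫⁻ ‖η(t + σᵢ c)‖ₑ dc ≠ 0` (explicit Haar product measures). [folklore] -/
theorem stub_teleportPackage_FibreMass :
    ∀ (N : ℕ) (i : Fin N) (η : MeasureTheory.Lp ℂ 2 (MeasureTheory.Measure.pi fun _ : Fin N × Fin 3 =>
        (AddCircle.haarAddCircle : MeasureTheory.Measure UnitAddCircle))),
      ∀ᵐ t ∂(MeasureTheory.Measure.pi fun _ : Fin N × Fin 3 => (AddCircle.haarAddCircle : MeasureTheory.Measure UnitAddCircle)),
        (η : UnitAddTorus (Fin N × Fin 3) → ℂ) t ≠ 0 →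
          (∫⁻ c, ‖(η : UnitAddTorus (Fin N × Fin 3) → ℂ)
              (t + Literature.MathematicalPhysics.QuantumManyBody.BoseGas.slotShift i c)‖ₑ
            ∂(MeasureTheory.Measure.pi fun _ : Fin 3 => (AddCircle.haarAddCircle : MeasureTheory.Measure UnitAddCircle))) ≠ 0 :=
  fun _ i η => ae_fibreMass_ne_zero i η

end Summit.AtomisticToContinuum.BoseEinsteinCondensation.Cruxes.RewardChordBound.Birth

end
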